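import Summits.AtomisticToContinuum.BoseEinsteinCondensation.Theses.BECHusimiAmplitudeGas
import Literature.MathematicalPhysics.QuantumManyBody.TorusBoseFockLayer
import Literature.MathematicalPhysics.QuantumManyBody.PeriodicKineticBudget
import HarnessLib

/-!
# Route BECHusimiAmplitudeGas — the support item `FastFractionBound`

Item stmt-AtomisticToContinuum-11993 of route `route-AtomisticToContinuum-BECHusimiAmplitudeGas`
(sub-problem `BoseEinsteinCondensation` of the summit `AtomisticToContinuum`): for an admissible
pair potential `v` and `η > 0` there is `M₀` such that for `M ≥ M₀`, `ρ < ρ₀(v)`, all large `N`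
and a suitable `δ = δ_N > 0`, every periodic `δ`-near-minimiser `Ψ` on the torus of side
`L = (N/ρ)^{1/3}` has at most `ηN` particles outside the cube of plane-wave modes `|n_k| ≤ R`,
`R = ⌊M L √(ρa)⌋`:  `N − Σ_{|n_k| ≤ R} ⟨e_n, γ_Ψ e_n⟩ ≤ ηN`.

Proof (every input is in the tree):
* the cube occupations are the momentum occupations `n_k(Ψ)` of `TorusBoseFockLayer.lean` over the
  band `momentumBand R`, and `Σ_k n_k(Ψ) = N` (`tsum_momentumOccupation_trialState`, one-body
  Parseval per particle slice), so the fast number is `Σ_{k ∉ band} n_k`;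
* modes outside the band have `|k|² ≥ 4π²(R+1)²/L²`, and `Σ_k |k|² n_k = ∫|∇Ψ|²`
  (`tsum_normSq_waveVector_mul_momentumOccupation`), whence
  `4π²(R+1)²/L² · n_fast ≤ kinetic ≤ periodicEnergy ≤ E₀^per + δ`;
* `E₀^per ≤ 4πρ₁a(1 + C a/b)N ≤ 8πρaN` for small `ρ` by the PROVED LSSY Theorem 2.2
  (`LSSY2005_upperBound_periodic_holds`; `a < ∞` by `scatteringLength_le_range`);
* with `(R+1)² ≥ M²L²ρa`, `M² ≥ 4/η` and `δ = 2π²ηN/L²` the arithmetic closes (the degenerate case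
  `a = 0` is covered by the same inequality: then `E₀^per = 0` and `(R+1)² ≥ 1`).

## References
* [LSSY2005] Lieb–Seiringer–Solovej–Yngvason, *The Mathematics of the Bose Gas and its
  Condensation*, Birkhäuser 2005: Thm. 2.2 (2.14), App. A (A.6), (A.10)–(A.11), App. C Remark 2.
* [Fournais2020] S. Fournais, *Length scales for BEC in the dilute Bose gas*, arXiv:2011.00309.
-/

noncomputable section

open MeasureTheory Filter
open scoped ENNReal NNReal BigOperators

namespace Summit.AtomisticToContinuum.BoseEinsteinCondensation.Theorems

open Literature.MathematicalPhysics.QuantumManyBody.BoseGas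

/-- The route's cube mode `e_i = cellWave L (i - R) / √(L³)` has `cellOccupation` equal to the
momentum occupation `n_{i-R}(Ψ)` of `TorusBoseFockLayer.lean` (both are `⟨φ_{i-R}, γ_Ψ φ_{i-R}⟩`
for the normalised plane wave restricted to the cell). [folklore] -/
theorem cellOccupation_cubeWave_eq_momentumOccupation (N : ℕ) (L : ℝ) (R : ℕ)
    (Ψ : Config N → ℂ) (i : Fin 3 → Fin (2 * R + 1)) :
    cellOccupation N L (fun x => cellWave L (fun k => ((i k : ℕ) : ℤ) - (R : ℤ)) x /
        (Real.sqrt (L ^ 3) : ℂ)) Ψ =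
      momentumOccupation N L (fun k => ((i k : ℕ) : ℤ) - (R : ℤ)) Ψ := by
  rw [momentumOccupation, cellOccupation, cellOccupation, indicator_planeWave]
  congr 1
  unfold planeWave
  congr 1
  funext x
  rw [div_eq_mul_inv, mul_comm]

/-- Reindexing the cube: summing `f (i - R)` over `i ∈ {0,…,2R}³` is summing `f` over the momentum
band `{-R,…,R}³ = momentumBand R`. [folklore] -/
theorem sum_cube_eq_sum_momentumBand (R : ℕ) (f : Momentum → ℝ≥0∞) :
    ∑ i : Fin 3 → Fin (2 * R + 1), f (fun k => ((i k : ℕ) : ℤ) - (R : ℤ)) =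
      ∑ n ∈ momentumBand R, f n := by
  refine Finset.sum_nbij' (fun i => fun k => ((i k : ℕ) : ℤ) - (R : ℤ))
    (fun n => fun k => ⟨min (n k + R).toNat (2 * R), by omega⟩) ?_ ?_ ?_ ?_ ?_
  · intro i _
    rw [mem_momentumBand]
    intro j
    have h := (i j).isLt
    rw [abs_le]
    constructor <;> omega
  · intro n _
    exact Finset.mem_univ _
  · intro i _
    funext k
    apply Fin.ext
    simp only
    have h := (i k).isLt
    omega
  · intro n hn
    rw [mem_momentumBand] at hn
    funext k
    have h := hn k
    rw [abs_le] at h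
    simp only
    omega
  · intro i _
    rfl

/-- Momentum labels outside the band `{-R,…,R}³` have `|n|² ≥ (R+1)²`. [folklore] -/
theorem sq_le_sum_sq_of_not_mem_momentumBand {R : ℕ} {n : Momentum} (hn : n ∉ momentumBand R) :
    ((R : ℝ) + 1) ^ 2 ≤ ∑ j, (n j : ℝ) ^ 2 := by
  rw [mem_momentumBand, not_forall] at hn
  obtain ⟨j, hj⟩ := hn
  rw [not_le] at hj
  have h1 : (R : ℤ) + 1 ≤ |n j| := hj
  have h2 : (R : ℝ) + 1 ≤ |(n j : ℝ)| := by exact_mod_cast h1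
  have h3 : ((R : ℝ) + 1) ^ 2 ≤ (n j : ℝ) ^ 2 := by
    calc ((R : ℝ) + 1) ^ 2 ≤ |(n j : ℝ)| ^ 2 := pow_le_pow_left₀ (by positivity) h2 2
      _ = (n j : ℝ) ^ 2 := sq_abs _
  exact h3.trans (Finset.single_le_sum (f := fun k => (n k : ℝ) ^ 2) (fun k _ => sq_nonneg _)
    (Finset.mem_univ j))

/-- **Excitations above the cutoff cost kinetic energy.** For a periodic trial state `Ψ` on the
torus of side `L` and a cutoff `R`, the number of particles outside the cube of modes `|n_k| ≤ R`
satisfies `(2π(R+1)/L)² · (N − Σ_{cube} ⟨e_i, γ_Ψ e_i⟩) ≤ ∫_{cell^N} |∇Ψ|²`: Parseval per particle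
slice (`Σ_k n_k = N`, `Σ_k |k|² n_k = kinetic`) and `|k|² ≥ 4π²(R+1)²/L²` off the cube.
[cite: LSSY2005, App. A (A.6), (A.10)–(A.11)] -/
theorem cutoffWeight_mul_fast_le_kinetic {N : ℕ} {L : ℝ} (hL : 0 < L) (R : ℕ)
    (Ψ : PeriodicTrialState N L) :
    ENNReal.ofReal (4 * Real.pi ^ 2 * ((R : ℝ) + 1) ^ 2 / L ^ 2) *
        ((N : ℝ≥0∞) - ∑ i : Fin 3 → Fin (2 * R + 1),
          cellOccupation N L (fun x => cellWave L (fun k => ((i k : ℕ) : ℤ) - (R : ℤ)) x /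
            (Real.sqrt (L ^ 3) : ℂ)) Ψ.ψ) ≤
      ∫⁻ X in cellN N L, kineticDensity Ψ.ψ X := by
  set occ : Momentum → ℝ≥0∞ := fun k => momentumOccupation N L k Ψ.ψ with hocc
  set B : Finset Momentum := momentumBand R with hB
  -- the cube sum is the band sum of momentum occupations
  have hcube : ∑ i : Fin 3 → Fin (2 * R + 1),
      cellOccupation N L (fun x => cellWave L (fun k => ((i k : ℕ) : ℤ) - (R : ℤ)) x /
        (Real.sqrt (L ^ 3) : ℂ)) Ψ.ψ = ∑ n ∈ B, occ n := by
    simp only [cellOccupation_cubeWave_eq_momentumOccupation]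
    exact sum_cube_eq_sum_momentumBand R occ
  -- Parseval: `N = Σ_band + Σ_fast`
  have hN : (N : ℝ≥0∞) = ∑ n ∈ B, occ n + ∑' k, ((B : Set Momentum)ᶜ).indicator occ k := by
    rw [← tsum_subtype ((B : Set Momentum)ᶜ) occ, ENNReal.sum_add_tsum_compl]
    exact (tsum_momentumOccupation_trialState hL Ψ).symm
  have hfast : (N : ℝ≥0∞) - ∑ i : Fin 3 → Fin (2 * R + 1),
      cellOccupation N L (fun x => cellWave L (fun k => ((i k : ℕ) : ℤ) - (R : ℤ)) x /
        (Real.sqrt (L ^ 3) : ℂ)) Ψ.ψ ≤ ∑' k, ((B : Set Momentum)ᶜ).indicator occ k := by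
    rw [hcube]
    exact tsub_le_iff_left.mpr hN.le
  -- kinetic energy in momentum space
  have hkin := tsum_normSq_waveVector_mul_momentumOccupation hL Ψ
  calc ENNReal.ofReal (4 * Real.pi ^ 2 * ((R : ℝ) + 1) ^ 2 / L ^ 2) * _
      ≤ ENNReal.ofReal (4 * Real.pi ^ 2 * ((R : ℝ) + 1) ^ 2 / L ^ 2) *
          ∑' k, ((B : Set Momentum)ᶜ).indicator occ k := mul_le_mul_right hfast _
    _ = ∑' k, ENNReal.ofReal (4 * Real.pi ^ 2 * ((R : ℝ) + 1) ^ 2 / L ^ 2) *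
          ((B : Set Momentum)ᶜ).indicator occ k := ENNReal.tsum_mul_left.symm
    _ ≤ ∑' k, ENNReal.ofReal (‖waveVector L k‖ ^ 2) * momentumOccupation N L k Ψ.ψ := by
        refine ENNReal.tsum_le_tsum fun k => ?_
        by_cases hk : k ∈ B
        · have : k ∉ ((B : Set Momentum)ᶜ) := fun h => h (Finset.mem_coe.mpr hk)
          rw [Set.indicator_of_notMem this, mul_zero]
          exact zero_le
        · have : k ∈ ((B : Set Momentum)ᶜ) := fun h => hk (Finset.mem_coe.mp h)
          rw [Set.indicator_of_mem this, hocc]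
          refine mul_le_mul_left (ENNReal.ofReal_le_ofReal ?_) _
          rw [norm_waveVector_sq]
          have hsq := sq_le_sum_sq_of_not_mem_momentumBand hk
          have hL2 : 0 < L ^ 2 := by positivity
          exact div_le_div_of_nonneg_right (by nlinarith [Real.pi_pos]) hL2.le
    _ = ∫⁻ X in cellN N L, kineticDensity Ψ.ψ X := hkin

/-- **Dilute-limit form of the LSSY upper bound.** For a repulsive finite-range `v` there are
`R₁ ≥ 0` (a range) and `ρ₀ > 0` such that `E₀^per(N, L) ≤ 8πρaN`, `ρ = N/L³`, whenever `N ≥ 2`,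
`L > 2R₁` and `ρ ≤ ρ₀` — from LSSY Thm. 2.2 `E₀^per ≤ 4πρ₁a(1 + C a/b)N` (proved in the tree) with
`ρ₁ ≤ ρ` and `C a/b ≤ 1` for `ρ` small; `a = scatteringLength v < ∞` by App. C Remark 2.
[cite: LSSY2005, Thm. 2.2 (2.14)] -/
theorem periodicGroundStateEnergy_le_dilute {v : ℝ → ℝ≥0∞} (hv : IsRepulsiveFiniteRange v) :
    ∃ R₁ ρ₀ : ℝ, 0 ≤ R₁ ∧ 0 < ρ₀ ∧ ∀ (N : ℕ) (L : ℝ), 2 ≤ N → 0 < L → 2 * R₁ < L →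
      (N : ℝ) / L ^ 3 ≤ ρ₀ →
      periodicGroundStateEnergy v N L ≤
        ENNReal.ofReal (8 * Real.pi * ((N : ℝ) / L ^ 3) * (scatteringLength v).toReal * N) := by
  obtain ⟨hmeas, R₀, hR₀⟩ := hv
  set R₁ : ℝ := max R₀ 0 with hR₁
  have hvR₁ : ∀ r, R₁ < r → v r = 0 := fun r hr => hR₀ r (lt_of_le_of_lt (le_max_left _ _) hr)
  have hatop : scatteringLength v ≠ ⊤ :=
    ne_top_of_le_ne_top ENNReal.ofReal_ne_top (scatteringLength_le_range (le_max_right _ _) hvR₁)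
  obtain ⟨C, c, hC, hc, hmain⟩ := LSSY2005_upperBound_periodic_holds v R₁ hmeas hvR₁ hatop
  set a : ℝ := (scatteringLength v).toReal with ha
  have ha0 : 0 ≤ a := ENNReal.toReal_nonneg
  set t : ℝ := min c (1 / C) with ht
  have ht0 : 0 < t := lt_min hc (by positivity)
  set ρ₀ : ℝ := 3 * (t / (a + 1)) ^ 3 / (4 * Real.pi) with hρ₀
  have hta : 0 < t / (a + 1) := div_pos ht0 (by linarith)
  have hρ₀pos : 0 < ρ₀ := by positivity
  refine ⟨R₁, ρ₀, le_max_right _ _, hρ₀pos, fun N L hN hL hRL hρ => ?_⟩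
  have hN1 : (1 : ℝ) ≤ (N : ℝ) - 1 := by
    have : (2 : ℝ) ≤ N := by exact_mod_cast hN
    linarith
  set ρ₁ : ℝ := ((N : ℝ) - 1) / L ^ 3 with hρ₁
  have hρ₁pos : 0 < ρ₁ := div_pos (by linarith) (by positivity)
  have hρ₁le : ρ₁ ≤ (N : ℝ) / L ^ 3 := div_le_div_of_nonneg_right (by linarith) (by positivity)
  set x : ℝ := 4 * Real.pi * ρ₁ / 3 with hx
  have hxpos : 0 < x := by positivity
  set b : ℝ := x ^ (-(1 : ℝ) / 3) with hb
  have hbpos : 0 < b := Real.rpow_pos_of_pos hxpos _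
  -- `a / b = a x^{1/3} ≤ a t/(a+1) ≤ t`
  have hxle : x ≤ (t / (a + 1)) ^ 3 := by
    have h1 : x ≤ 4 * Real.pi * ρ₀ / 3 := by
      rw [hx]
      gcongr
      exact hρ₁le.trans hρ
    have h2 : 4 * Real.pi * ρ₀ / 3 = (t / (a + 1)) ^ 3 := by
      rw [hρ₀]
      field_simp
    linarith
  have hx3 : x ^ ((1 : ℝ) / 3) ≤ t / (a + 1) := by
    calc x ^ ((1 : ℝ) / 3) ≤ ((t / (a + 1)) ^ 3) ^ ((1 : ℝ) / 3) :=
          Real.rpow_le_rpow hxpos.le hxle (by norm_num)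
      _ = t / (a + 1) := by
          rw [show ((1 : ℝ) / 3) = ((3 : ℕ) : ℝ)⁻¹ by norm_num]
          exact Real.pow_rpow_inv_natCast hta.le three_ne_zero
  have hab : a / b = a * x ^ ((1 : ℝ) / 3) := by
    rw [hb, neg_div, Real.rpow_neg hxpos.le, div_inv_eq_mul]
  have habt : a / b ≤ t := by
    rw [hab]
    calc a * x ^ ((1 : ℝ) / 3) ≤ a * (t / (a + 1)) :=
          mul_le_mul_of_nonneg_left hx3 ha0
      _ = t * (a / (a + 1)) := by ring
      _ ≤ t * 1 := mul_le_mul_of_nonneg_left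
          ((div_le_one (by linarith)).mpr (by linarith)) ht0.le
      _ = t := mul_one t
  have habc : a / b ≤ c := habt.trans (min_le_left _ _)
  have hCab : C * (a / b) ≤ 1 := by
    calc C * (a / b) ≤ C * (1 / C) :=
          mul_le_mul_of_nonneg_left (habt.trans (min_le_right _ _)) hC.le
      _ = 1 := by field_simp
  have hab0 : 0 ≤ a / b := div_nonneg ha0 hbpos.le
  have hE := hmain N L hN hL hRL habc
  refine hE.trans (ENNReal.ofReal_le_ofReal ?_)
  have hN0 : (0 : ℝ) ≤ N := N.cast_nonneg
  have h1 : 4 * Real.pi * ρ₁ * a * (1 + C * (a / b)) ≤ 4 * Real.pi * ((N : ℝ) / L ^ 3) * a * 2 := by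
    apply mul_le_mul _ (by linarith) (by positivity) (by positivity)
    exact mul_le_mul_of_nonneg_right (by nlinarith [Real.pi_pos]) ha0
  calc 4 * Real.pi * ρ₁ * a * (1 + C * (a / b)) * N
      ≤ 4 * Real.pi * ((N : ℝ) / L ^ 3) * a * 2 * N := mul_le_mul_of_nonneg_right h1 hN0
    _ = 8 * Real.pi * ((N : ℝ) / L ^ 3) * a * N := by ring

/-- The real-arithmetic heart of `FastFractionBound`: with `x = R + 1 > M L √(ρa)`, `x ≥ 1`,
`ηM² ≥ 4` and `δ = 2π²ηN/L²`, one has `8πρaN + δ ≤ ηN · 4π²x²/L²`. [folklore] -/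
theorem fast_fraction_arith {η M L ρ a x : ℝ} {N : ℕ} (hη : 0 < η) (hM : 0 < M)
    (hηM : 4 ≤ η * M ^ 2) (hL : 0 < L) (hρ : 0 < ρ) (ha : 0 ≤ a)
    (hx1 : 1 ≤ x) (hx : M * L * Real.sqrt (ρ * a) < x) :
    8 * Real.pi * ρ * a * N + 2 * Real.pi ^ 2 * η * N / L ^ 2 ≤
      η * N * (4 * Real.pi ^ 2 * x ^ 2 / L ^ 2) := by
  have hL2 : 0 < L ^ 2 := by positivity
  have hN0 : (0 : ℝ) ≤ N := N.cast_nonneg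
  have hπ : 1 ≤ Real.pi := by linarith [Real.pi_gt_three]
  have hS : M ^ 2 * L ^ 2 * (ρ * a) ≤ x ^ 2 := by
    have h0 : 0 ≤ M * L * Real.sqrt (ρ * a) := by positivity
    have h := pow_le_pow_left₀ h0 hx.le 2
    rwa [mul_pow, mul_pow, Real.sq_sqrt (by positivity)] at h
  have hcoef : 8 * Real.pi ≤ 2 * Real.pi ^ 2 * η * M ^ 2 := by
    have h1 : 4 ≤ Real.pi * (η * M ^ 2) := by nlinarith
    nlinarith [Real.pi_pos]
  have hT : 0 ≤ ρ * a * N * L ^ 2 := by positivity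
  have hc0 : 0 ≤ 2 * Real.pi ^ 2 * η * N := by positivity
  rw [show η * N * (4 * Real.pi ^ 2 * x ^ 2 / L ^ 2) = (η * N * (4 * Real.pi ^ 2 * x ^ 2)) / L ^ 2
      by ring, le_div_iff₀ hL2, add_mul, div_mul_cancel₀ _ hL2.ne']
  calc 8 * Real.pi * ρ * a * N * L ^ 2 + 2 * Real.pi ^ 2 * η * N
      = (8 * Real.pi) * (ρ * a * N * L ^ 2) + 2 * Real.pi ^ 2 * η * N := by ring
    _ ≤ (2 * Real.pi ^ 2 * η * M ^ 2) * (ρ * a * N * L ^ 2) + 2 * Real.pi ^ 2 * η * N :=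
        add_le_add (mul_le_mul_of_nonneg_right hcoef hT) le_rfl
    _ = (2 * Real.pi ^ 2 * η * N) * (M ^ 2 * L ^ 2 * (ρ * a) + 1) := by ring
    _ ≤ (2 * Real.pi ^ 2 * η * N) * (x ^ 2 + 1) :=
        mul_le_mul_of_nonneg_left (add_le_add hS le_rfl) hc0
    _ ≤ (2 * Real.pi ^ 2 * η * N) * (2 * x ^ 2) :=
        mul_le_mul_of_nonneg_left (by nlinarith) hc0
    _ = η * N * (4 * Real.pi ^ 2 * x ^ 2) := by ring

/-- **`FastFractionBound` holds** (settles stmt-AtomisticToContinuum-11993; the type is the exact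
route decl): for admissible `v` and `η > 0`, with `M₀ = 2/√η`, for `M ≥ M₀`, `ρ < ρ₀(v)` (the
dilute threshold of LSSY Thm. 2.2), all large `N` (`N ≥ 2`, `L = (N/ρ)^{1/3} > 2R₀`) and
`δ = 2π²ηN/L²`, every periodic `δ`-near-minimiser has `N − Σ_{cube} ⟨e_i, γ_Ψ e_i⟩ ≤ ηN`:
`4π²(R+1)²/L² · n_fast ≤ kinetic ≤ E₀^per + δ ≤ 8πρaN + δ ≤ ηN · 4π²(R+1)²/L²`.
[cite: LSSY2005, Thm. 2.2 (2.14) and App. A (A.6), (A.10)–(A.11)] -/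
theorem fastFractionBound_proof :
    Summit.AtomisticToContinuum.BoseEinsteinCondensation.Theses.BECHusimiAmplitudeGas.FastFractionBound := by
  unfold Summit.AtomisticToContinuum.BoseEinsteinCondensation.Theses.BECHusimiAmplitudeGas.FastFractionBound
  intro v hv η hη
  obtain ⟨R₁, ρ₀, hR₁, hρ₀, hE⟩ := periodicGroundStateEnergy_le_dilute hv
  refine ⟨2 / Real.sqrt η, fun M hM => ⟨ρ₀, hρ₀, fun ρ hρ hρρ₀ => ?_⟩⟩
  have hsη : 0 < Real.sqrt η := Real.sqrt_pos.mpr hη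
  have hM0 : 0 < M := lt_of_lt_of_le (by positivity) hM
  have hηM : 4 ≤ η * M ^ 2 := by
    have h1 : 2 ≤ M * Real.sqrt η := by rwa [div_le_iff₀ hsη] at hM
    have h2 : (M * Real.sqrt η) ^ 2 = η * M ^ 2 := by
      rw [mul_pow, Real.sq_sqrt hη.le]; ring
    nlinarith
  filter_upwards [eventually_ge_atTop 2, (tendsto_sideLength_atTop hρ).eventually_gt_atTop (2 * R₁)]
    with N hN2 hNL
  have hNpos' : 0 < N := lt_of_lt_of_le two_pos hN2
  have hNpos : (0 : ℝ) < N := by exact_mod_cast hNpos'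
  have hρN : (N : ℝ) / sideLength ρ N ^ 3 = ρ := div_sideLength_pow_three hρ hNpos'
  have hL : 0 < sideLength ρ N := by
    unfold sideLength; exact Real.rpow_pos_of_pos (div_pos hNpos hρ) _
  generalize sideLength ρ N = L at hL hρN hNL ⊢
  set a : ℝ := (scatteringLength v).toReal with hadef
  have ha0 : 0 ≤ a := ENNReal.toReal_nonneg
  have hE₀ : periodicGroundStateEnergy v N L ≤ ENNReal.ofReal (8 * Real.pi * ρ * a * N) := by
    have h := hE N L hN2 hL hNL (by rw [hρN]; exact hρρ₀.le)
    rwa [hρN] at h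
  refine ⟨ENNReal.ofReal (2 * Real.pi ^ 2 * η * N / L ^ 2), ENNReal.ofReal_pos.mpr (by positivity),
    fun Ψ hΨ => ?_⟩
  show ((N : ℝ≥0∞) - ∑ i : Fin 3 → Fin (2 * ⌊M * L * Real.sqrt (ρ * a)⌋₊ + 1),
      cellOccupation N L (fun x => cellWave L
        (fun k => ((i k : ℕ) : ℤ) - (⌊M * L * Real.sqrt (ρ * a)⌋₊ : ℤ)) x /
          (Real.sqrt (L ^ 3) : ℂ)) Ψ.ψ) ≤ ENNReal.ofReal (η * N)
  set R : ℕ := ⌊M * L * Real.sqrt (ρ * a)⌋₊ with hRdef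
  have hcore := cutoffWeight_mul_fast_le_kinetic hL R Ψ
  set nf : ℝ≥0∞ := (N : ℝ≥0∞) - ∑ i : Fin 3 → Fin (2 * R + 1),
      cellOccupation N L (fun x => cellWave L (fun k => ((i k : ℕ) : ℤ) - (R : ℤ)) x /
        (Real.sqrt (L ^ 3) : ℂ)) Ψ.ψ with hnf
  set w : ℝ := 4 * Real.pi ^ 2 * ((R : ℝ) + 1) ^ 2 / L ^ 2 with hw
  have hw0 : 0 < w := by positivity
  have hRx : M * L * Real.sqrt (ρ * a) < (R : ℝ) + 1 := Nat.lt_floor_add_one _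
  have hR1 : (1 : ℝ) ≤ (R : ℝ) + 1 := by simp
  have key := fast_fraction_arith (N := N) hη hM0 hηM hL hρ ha0 hR1 hRx
  have hchain : ENNReal.ofReal w * nf ≤ ENNReal.ofReal (η * N) * ENNReal.ofReal w := by
    calc ENNReal.ofReal w * nf ≤ ∫⁻ X in cellN N L, kineticDensity Ψ.ψ X := hcore
      _ ≤ periodicEnergy v Ψ := lintegral_kineticDensity_le_periodicEnergy v Ψ
      _ ≤ periodicGroundStateEnergy v N L + ENNReal.ofReal (2 * Real.pi ^ 2 * η * N / L ^ 2) := hΨ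
      _ ≤ ENNReal.ofReal (8 * Real.pi * ρ * a * N) +
            ENNReal.ofReal (2 * Real.pi ^ 2 * η * N / L ^ 2) := add_le_add hE₀ le_rfl
      _ = ENNReal.ofReal (8 * Real.pi * ρ * a * N + 2 * Real.pi ^ 2 * η * N / L ^ 2) :=
            (ENNReal.ofReal_add (by positivity) (by positivity)).symm
      _ ≤ ENNReal.ofReal (η * N * w) := ENNReal.ofReal_le_ofReal key
      _ = ENNReal.ofReal (η * N) * ENNReal.ofReal w := ENNReal.ofReal_mul (by positivity)
  rw [mul_comm] at hchain
  exact (ENNReal.mul_le_mul_iff_left (ENNReal.ofReal_pos.mpr hw0).ne' ENNReal.ofReal_ne_top).mp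
    hchain

end Summit.AtomisticToContinuum.BoseEinsteinCondensation.Theorems

end
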